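import Summits.AtomisticToContinuum.HydrodynamicLimit.Theorems.CollisionIsometryCLTAdaptedWeightCLTBHEntropyBudgetTransport
import Summits.AtomisticToContinuum.HydrodynamicLimit.Theorems.CollisionIsometryCLTAdaptedWeightCLTCBPointwise

/-!
# Entropy budget (stub `stub_entropyBudget`, line `block-h-dissipation-closure`, crux `AdaptedWeightCLT`,
stmt-AtomisticToContinuum-14868; `--supports`) — helper 11: the transport rate for an admissible cell-kernel
family (mechanism (iii) of the stub, deterministic part)

* the `V`-dependence of the size constants of helper 9 is POLYNOMIAL: `V (M(V) + Q(V)) ≤ K(h,δ) (1 + V)⁸`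
  (`Θ ≍ V²`, `|log 2πΘ| ≤ |log 2πh²| + 4V²/(3h²)`);
* for `AdmissibleKernel γ C ψ`, `h > 0`, `0 < δ ≤ 1`: `r ↦ S_N(freeFlight r w)` is differentiable everywhere with a
  time-uniform bounded derivative (every `N`, every start), and — THE TRANSPORT RATE —
  `|d/dr|₀ S_N(freeFlight r w)| ≤ K(C,h,δ) (N+1)^γ (1 + V)⁸` for `(N+1)^{-γ} < 1/2` and any velocity bound `V`
  (`L ((N+1)^{-γ})³ = C (N+1)^γ`).
-/

namespace Summit.AtomisticToContinuum.HydrodynamicLimit.Theorems.BlockHDissipation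

open scoped BigOperators Topology Classical MeasureTheory ENNReal InnerProductSpace
open Filter Set MeasureTheory
open Literature.Analysis.FluidPDE
open Literature.Analysis.FunctionSpaces (Torus.IsSmooth)
open Summit.AtomisticToContinuum.HydrodynamicLimit.Theorems.ContactSourceDuhamel (T3 V3 Cfg Vel Flow Flows)
open Summit.AtomisticToContinuum.HydrodynamicLimit.Theorems.ContactSourceDuhamel.TimeLocal
open Literature.MathematicalPhysics.KineticTheory (localMaxwellian_pos localMaxwellian_nonneg continuous_localMaxwellian)

noncomputable section

namespace EntropyBudget

variable {N : ℕ} {ψ : ℕ → T3 → ℝ} {h δ : ℝ} (w : Cfg N) (x : T3)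


/-! ## The velocity dependence of the rate is polynomial -/

/-- `|log 2πΘ| ≤ |log 2πh²| + 4V²/(3h²)` for `Θ = h² + (2V)²/3` (`log(1 + y) ≤ y`). -/
theorem abs_log_Theta_le (hh : 0 < h) (V : ℝ) :
    |Real.log (2 * Real.pi * (h ^ 2 + (2 * V) ^ 2 / 3))| ≤ |Real.log (2 * Real.pi * h ^ 2)| + 4 * V ^ 2 / (3 * h ^ 2) := by
  have h2 : 0 < 2 * Real.pi * h ^ 2 := by positivity
  have hy : 0 ≤ 4 * V ^ 2 / (3 * h ^ 2) := by positivity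
  have e : 2 * Real.pi * (h ^ 2 + (2 * V) ^ 2 / 3) = 2 * Real.pi * h ^ 2 * (1 + 4 * V ^ 2 / (3 * h ^ 2)) := by
    field_simp; ring
  rw [e, Real.log_mul h2.ne' (by positivity)]
  have h3 : 0 ≤ Real.log (1 + 4 * V ^ 2 / (3 * h ^ 2)) := Real.log_nonneg (by linarith)
  have h4 : Real.log (1 + 4 * V ^ 2 / (3 * h ^ 2)) ≤ 4 * V ^ 2 / (3 * h ^ 2) := by
    have := Real.log_le_sub_one_of_pos (by positivity : 0 < 1 + 4 * V ^ 2 / (3 * h ^ 2)); linarith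
  calc |Real.log (2 * Real.pi * h ^ 2) + Real.log (1 + 4 * V ^ 2 / (3 * h ^ 2))|
      ≤ |Real.log (2 * Real.pi * h ^ 2)| + |Real.log (1 + 4 * V ^ 2 / (3 * h ^ 2))| := abs_add_le _ _
    _ ≤ _ := by rw [abs_of_nonneg h3]; linarith

set_option maxHeartbeats 400000 in
-- long explicit bookkeeping of the `V`-dependence of helper 9's constants
/-- **POLYNOMIAL VELOCITY DEPENDENCE**: there is `K(h, δ)` with `V · (M(V) + Q(V)) ≤ K (1 + V)⁸` for every
`V ≥ 0` (all the `V`-dependence of helper 9's constants is through `V, V², Θ ≍ V²` and `log Θ`). -/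
theorem exists_poly_bound (hh : 0 < h) (δ : ℝ) : ∃ K : ℝ, ∀ V : ℝ, 0 ≤ V →
    V * ((|Real.log ((2 * Real.pi * h ^ 2) ^ (-(3 : ℝ) / 2))| + |Real.log δ| +
          3 / 2 * (|Real.log (2 * Real.pi * h ^ 2)| + |Real.log (2 * Real.pi * (h ^ 2 + (2 * V) ^ 2 / 3))|) + 3 / 2) +
      (2 * ((1 + |Real.log ((2 * Real.pi * h ^ 2) ^ (-(3 : ℝ) / 2))| + |Real.log δ| +
          3 / 2 * (|Real.log (2 * Real.pi * h ^ 2)| + |Real.log (2 * Real.pi * (h ^ 2 + (2 * V) ^ 2 / 3))|)) +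
            3 * (h ^ 2 + (2 * V) ^ 2 / 3) / (2 * h ^ 2)) +
        (1 + |Real.log ((2 * Real.pi * h ^ 2) ^ (-(3 : ℝ) / 2))| + |Real.log δ| +
          3 / 2 * (|Real.log (2 * Real.pi * h ^ 2)| + |Real.log (2 * Real.pi * (h ^ 2 + (2 * V) ^ 2 / 3))|)) *
            ((4 * V ^ 2 + V) / h ^ 2) +
        3 * (h ^ 2 + (2 * V) ^ 2 / 3) * ((1 + |Real.log ((2 * Real.pi * h ^ 2) ^ (-(3 : ℝ) / 2))| + |Real.log δ| +
          3 / 2 * (|Real.log (2 * Real.pi * h ^ 2)| + |Real.log (2 * Real.pi * (h ^ 2 + (2 * V) ^ 2 / 3))|)) *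
            (4 * V ^ 2 / (3 * h ^ 4) + V / h ^ 2) + (4 * V ^ 2 + V) / h ^ 2 / (2 * h ^ 2)) +
        (∫ w, ‖w‖ ^ 4 ∂ProbabilityTheory.stdGaussian V3) * (h ^ 2 + (2 * V) ^ 2 / 3) ^ 2 *
          ((4 * V ^ 2 / (3 * h ^ 4) + V / h ^ 2) / (2 * h ^ 2)))) ≤ K * (1 + V) ^ 8 := by
  -- the `V`-free constants
  obtain ⟨K4, hK4⟩ : ∃ K : ℝ, K = ∫ w, ‖w‖ ^ 4 ∂ProbabilityTheory.stdGaussian V3 := ⟨_, rfl⟩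
  have hK40 : 0 ≤ K4 := by rw [hK4]; exact K4_nonneg
  obtain ⟨c₀, hc₀⟩ : ∃ c : ℝ, c = 1 + |Real.log ((2 * Real.pi * h ^ 2) ^ (-(3 : ℝ) / 2))| + |Real.log δ| +
      3 * |Real.log (2 * Real.pi * h ^ 2)| + 2 / h ^ 2 := ⟨_, rfl⟩
  have hc₀1 : 1 ≤ c₀ := by
    rw [hc₀]
    have : 0 < 2 / h ^ 2 := by positivity
    linarith [abs_nonneg (Real.log δ), abs_nonneg (Real.log ((2 * Real.pi * h ^ 2) ^ (-(3 : ℝ) / 2))),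
      abs_nonneg (Real.log (2 * Real.pi * h ^ 2))]
  have hc₀0 : 0 ≤ c₀ := by linarith
  obtain ⟨cΘ, hcΘ⟩ : ∃ c : ℝ, c = h ^ 2 + 4 / 3 := ⟨_, rfl⟩
  have hcΘ0 : 0 ≤ cΘ := by rw [hcΘ]; positivity
  obtain ⟨b₀, hb₀⟩ : ∃ c : ℝ, c = 5 / h ^ 2 := ⟨_, rfl⟩
  obtain ⟨b₁, hb₁⟩ : ∃ c : ℝ, c = 4 / (3 * h ^ 4) + 1 / h ^ 2 := ⟨_, rfl⟩
  have hb₀0 : 0 ≤ b₀ := by rw [hb₀]; positivity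
  have hb₁0 : 0 ≤ b₁ := by rw [hb₁]; positivity
  -- the total constant
  refine ⟨(c₀ + 1 / 2) + (2 * (c₀ + 3 * cΘ / (2 * h ^ 2)) + c₀ * b₀ + 3 * cΘ * (c₀ * b₁ + b₀ / (2 * h ^ 2)) +
    K4 * cΘ ^ 2 * (b₁ / (2 * h ^ 2))), fun V hV0 => ?_⟩
  rw [← hK4]
  set u : ℝ := 1 + V with hu
  have hu1 : 1 ≤ u := by rw [hu]; linarith
  have hu0 : 0 ≤ u := by linarith
  have hVu : V ≤ u := by rw [hu]; linarith
  have hV2 : V ^ 2 ≤ u ^ 2 := pow_le_pow_left₀ hV0 hVu 2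
  have hu2 : 1 ≤ u ^ 2 := one_le_pow₀ hu1
  -- the pieces
  have hlog := abs_log_Theta_le hh V
  set ℓ : ℝ := |Real.log (2 * Real.pi * (h ^ 2 + (2 * V) ^ 2 / 3))| with hℓ
  set cm : ℝ := 1 + |Real.log ((2 * Real.pi * h ^ 2) ^ (-(3 : ℝ) / 2))| + |Real.log δ| +
    3 / 2 * (|Real.log (2 * Real.pi * h ^ 2)| + ℓ) with hcm
  have hcm_le : cm ≤ c₀ * u ^ 2 := by
    have h1 : 1 + |Real.log ((2 * Real.pi * h ^ 2) ^ (-(3 : ℝ) / 2))| + |Real.log δ| + 3 * |Real.log (2 * Real.pi * h ^ 2)| ≤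
        (1 + |Real.log ((2 * Real.pi * h ^ 2) ^ (-(3 : ℝ) / 2))| + |Real.log δ| + 3 * |Real.log (2 * Real.pi * h ^ 2)|) * u ^ 2 :=
      le_mul_of_one_le_right (by positivity) hu2
    have h2 : 3 / 2 * (4 * V ^ 2 / (3 * h ^ 2)) ≤ 2 / h ^ 2 * u ^ 2 := by
      rw [show 3 / 2 * (4 * V ^ 2 / (3 * h ^ 2)) = 2 / h ^ 2 * V ^ 2 by field_simp; ring]
      exact mul_le_mul_of_nonneg_left hV2 (by positivity)
    have e : (1 + |Real.log ((2 * Real.pi * h ^ 2) ^ (-(3 : ℝ) / 2))| + |Real.log δ| + 3 * |Real.log (2 * Real.pi * h ^ 2)| +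
        2 / h ^ 2) * u ^ 2 = (1 + |Real.log ((2 * Real.pi * h ^ 2) ^ (-(3 : ℝ) / 2))| + |Real.log δ| +
          3 * |Real.log (2 * Real.pi * h ^ 2)|) * u ^ 2 + 2 / h ^ 2 * u ^ 2 := by ring
    rw [hcm, hc₀, e]
    linarith only [h1, h2, hlog]
  have hcm0 : 0 ≤ cm := by rw [hcm]; positivity
  set Θ : ℝ := h ^ 2 + (2 * V) ^ 2 / 3 with hΘ
  have hΘ_le : Θ ≤ cΘ * u ^ 2 := by
    have h1 : h ^ 2 ≤ h ^ 2 * u ^ 2 := le_mul_of_one_le_right (sq_nonneg _) hu2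
    have h2 : (2 * V) ^ 2 / 3 ≤ 4 / 3 * u ^ 2 := by
      rw [show (2 * V) ^ 2 / 3 = 4 / 3 * V ^ 2 by ring]
      exact mul_le_mul_of_nonneg_left hV2 (by norm_num)
    have e : cΘ * u ^ 2 = h ^ 2 * u ^ 2 + 4 / 3 * u ^ 2 := by rw [hcΘ]; ring
    rw [hΘ, e]
    linarith only [h1, h2]
  have hΘ0 : 0 ≤ Θ := by rw [hΘ]; positivity
  set a₀ : ℝ := (4 * V ^ 2 + V) / h ^ 2 with ha₀
  set a₁ : ℝ := 4 * V ^ 2 / (3 * h ^ 4) + V / h ^ 2 with ha₁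
  have hu_sq : u ≤ u ^ 2 := le_self_pow₀ hu1 two_ne_zero
  have ha₀_le : a₀ ≤ b₀ * u ^ 2 := by
    rw [ha₀, hb₀, div_mul_eq_mul_div, div_le_div_iff_of_pos_right (by positivity)]
    linarith only [hV2, hVu, hu_sq]
  have ha₁_le : a₁ ≤ b₁ * u ^ 2 := by
    rw [ha₁, hb₁]
    have h1 : 4 * V ^ 2 / (3 * h ^ 4) ≤ 4 / (3 * h ^ 4) * u ^ 2 := by
      rw [show 4 * V ^ 2 / (3 * h ^ 4) = 4 / (3 * h ^ 4) * V ^ 2 by ring]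
      exact mul_le_mul_of_nonneg_left hV2 (by positivity)
    have h2 : V / h ^ 2 ≤ 1 / h ^ 2 * u ^ 2 := by
      rw [show V / h ^ 2 = 1 / h ^ 2 * V by ring]
      exact mul_le_mul_of_nonneg_left (hVu.trans hu_sq) (by positivity)
    have e : (4 / (3 * h ^ 4) + 1 / h ^ 2) * u ^ 2 = 4 / (3 * h ^ 4) * u ^ 2 + 1 / h ^ 2 * u ^ 2 := by ring
    rw [e]
    linarith only [h1, h2]
  have ha₀0 : 0 ≤ a₀ := by rw [ha₀]; positivity
  have ha₁0 : 0 ≤ a₁ := by rw [ha₁]; positivity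
  -- the entropy size and the integrated size
  have hM : |Real.log ((2 * Real.pi * h ^ 2) ^ (-(3 : ℝ) / 2))| + |Real.log δ| +
      3 / 2 * (|Real.log (2 * Real.pi * h ^ 2)| + ℓ) + 3 / 2 ≤ (c₀ + 1 / 2) * u ^ 2 := by
    have : |Real.log ((2 * Real.pi * h ^ 2) ^ (-(3 : ℝ) / 2))| + |Real.log δ| +
        3 / 2 * (|Real.log (2 * Real.pi * h ^ 2)| + ℓ) + 3 / 2 = cm + 1 / 2 := by rw [hcm]; ring
    have h2 : (1 : ℝ) / 2 ≤ 1 / 2 * u ^ 2 := by linarith only [hu2]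
    have e : (c₀ + 1 / 2) * u ^ 2 = c₀ * u ^ 2 + 1 / 2 * u ^ 2 := by ring
    rw [this, e]
    linarith only [hcm_le, h2]
  have hQ : 2 * (cm + 3 * Θ / (2 * h ^ 2)) + cm * a₀ + 3 * Θ * (cm * a₁ + a₀ / (2 * h ^ 2)) + K4 * Θ ^ 2 * (a₁ / (2 * h ^ 2)) ≤
      2 * (c₀ * u ^ 2 + 3 * (cΘ * u ^ 2) / (2 * h ^ 2)) + (c₀ * u ^ 2) * (b₀ * u ^ 2) +
        3 * (cΘ * u ^ 2) * ((c₀ * u ^ 2) * (b₁ * u ^ 2) + (b₀ * u ^ 2) / (2 * h ^ 2)) +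
        K4 * (cΘ * u ^ 2) ^ 2 * ((b₁ * u ^ 2) / (2 * h ^ 2)) := by
    gcongr
  have hpoly : 2 * (c₀ * u ^ 2 + 3 * (cΘ * u ^ 2) / (2 * h ^ 2)) + (c₀ * u ^ 2) * (b₀ * u ^ 2) +
      3 * (cΘ * u ^ 2) * ((c₀ * u ^ 2) * (b₁ * u ^ 2) + (b₀ * u ^ 2) / (2 * h ^ 2)) +
      K4 * (cΘ * u ^ 2) ^ 2 * ((b₁ * u ^ 2) / (2 * h ^ 2)) ≤
      (2 * (c₀ + 3 * cΘ / (2 * h ^ 2)) + c₀ * b₀ + 3 * cΘ * (c₀ * b₁ + b₀ / (2 * h ^ 2)) + K4 * cΘ ^ 2 * (b₁ / (2 * h ^ 2))) * u ^ 6 := by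
    have hu26 : u ^ 2 ≤ u ^ 6 := pow_le_pow_right₀ hu1 (by norm_num)
    have hu46 : u ^ 4 ≤ u ^ 6 := pow_le_pow_right₀ hu1 (by norm_num)
    have e : 2 * (c₀ * u ^ 2 + 3 * (cΘ * u ^ 2) / (2 * h ^ 2)) + (c₀ * u ^ 2) * (b₀ * u ^ 2) +
        3 * (cΘ * u ^ 2) * ((c₀ * u ^ 2) * (b₁ * u ^ 2) + (b₀ * u ^ 2) / (2 * h ^ 2)) +
        K4 * (cΘ * u ^ 2) ^ 2 * ((b₁ * u ^ 2) / (2 * h ^ 2)) =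
        2 * (c₀ + 3 * cΘ / (2 * h ^ 2)) * u ^ 2 + (c₀ * b₀ + 3 * cΘ * (b₀ / (2 * h ^ 2))) * u ^ 4 +
        (3 * cΘ * (c₀ * b₁) + K4 * cΘ ^ 2 * (b₁ / (2 * h ^ 2))) * u ^ 6 := by ring
    rw [e]
    have k2 : 0 ≤ 2 * (c₀ + 3 * cΘ / (2 * h ^ 2)) := by positivity
    have k4 : 0 ≤ c₀ * b₀ + 3 * cΘ * (b₀ / (2 * h ^ 2)) := by positivity
    have m2 := mul_le_mul_of_nonneg_left hu26 k2
    have m4 := mul_le_mul_of_nonneg_left hu46 k4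
    have e2 : (2 * (c₀ + 3 * cΘ / (2 * h ^ 2)) + c₀ * b₀ + 3 * cΘ * (c₀ * b₁ + b₀ / (2 * h ^ 2)) + K4 * cΘ ^ 2 * (b₁ / (2 * h ^ 2))) * u ^ 6 =
        2 * (c₀ + 3 * cΘ / (2 * h ^ 2)) * u ^ 6 + (c₀ * b₀ + 3 * cΘ * (b₀ / (2 * h ^ 2))) * u ^ 6 +
        (3 * cΘ * (c₀ * b₁) + K4 * cΘ ^ 2 * (b₁ / (2 * h ^ 2))) * u ^ 6 := by ring
    rw [e2]
    linarith only [m2, m4]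
  -- assemble: `V · (M + Q) ≤ u · K u⁶ ≤ K u⁸`
  have hu78 : u ^ 7 ≤ u ^ 8 := pow_le_pow_right₀ hu1 (by norm_num)
  have hK0 : 0 ≤ (c₀ + 1 / 2) + (2 * (c₀ + 3 * cΘ / (2 * h ^ 2)) + c₀ * b₀ + 3 * cΘ * (c₀ * b₁ + b₀ / (2 * h ^ 2)) +
      K4 * cΘ ^ 2 * (b₁ / (2 * h ^ 2))) := by positivity
  have hsum : |Real.log ((2 * Real.pi * h ^ 2) ^ (-(3 : ℝ) / 2))| + |Real.log δ| +
      3 / 2 * (|Real.log (2 * Real.pi * h ^ 2)| + ℓ) + 3 / 2 +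
      (2 * (cm + 3 * Θ / (2 * h ^ 2)) + cm * a₀ + 3 * Θ * (cm * a₁ + a₀ / (2 * h ^ 2)) + K4 * Θ ^ 2 * (a₁ / (2 * h ^ 2))) ≤
      ((c₀ + 1 / 2) + (2 * (c₀ + 3 * cΘ / (2 * h ^ 2)) + c₀ * b₀ + 3 * cΘ * (c₀ * b₁ + b₀ / (2 * h ^ 2)) +
        K4 * cΘ ^ 2 * (b₁ / (2 * h ^ 2)))) * u ^ 6 := by
    have hu26 : u ^ 2 ≤ u ^ 6 := pow_le_pow_right₀ hu1 (by norm_num)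
    have m2 := mul_le_mul_of_nonneg_left hu26 (by positivity : 0 ≤ c₀ + 1 / 2)
    have hQ' := hQ.trans hpoly
    have e3 : ((c₀ + 1 / 2) + (2 * (c₀ + 3 * cΘ / (2 * h ^ 2)) + c₀ * b₀ + 3 * cΘ * (c₀ * b₁ + b₀ / (2 * h ^ 2)) +
        K4 * cΘ ^ 2 * (b₁ / (2 * h ^ 2)))) * u ^ 6 = (c₀ + 1 / 2) * u ^ 6 +
        (2 * (c₀ + 3 * cΘ / (2 * h ^ 2)) + c₀ * b₀ + 3 * cΘ * (c₀ * b₁ + b₀ / (2 * h ^ 2)) + K4 * cΘ ^ 2 * (b₁ / (2 * h ^ 2))) *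
          u ^ 6 := by ring
    rw [e3]
    linarith only [hM, hQ', m2]
  have hlhs0 : 0 ≤ |Real.log ((2 * Real.pi * h ^ 2) ^ (-(3 : ℝ) / 2))| + |Real.log δ| +
      3 / 2 * (|Real.log (2 * Real.pi * h ^ 2)| + ℓ) + 3 / 2 +
      (2 * (cm + 3 * Θ / (2 * h ^ 2)) + cm * a₀ + 3 * Θ * (cm * a₁ + a₀ / (2 * h ^ 2)) + K4 * Θ ^ 2 * (a₁ / (2 * h ^ 2))) := by
    positivity
  calc _ ≤ u * (((c₀ + 1 / 2) + (2 * (c₀ + 3 * cΘ / (2 * h ^ 2)) + c₀ * b₀ + 3 * cΘ * (c₀ * b₁ + b₀ / (2 * h ^ 2)) +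
        K4 * cΘ ^ 2 * (b₁ / (2 * h ^ 2)))) * u ^ 6) := mul_le_mul hVu hsum hlhs0 hu0
    _ = ((c₀ + 1 / 2) + (2 * (c₀ + 3 * cΘ / (2 * h ^ 2)) + c₀ * b₀ + 3 * cΘ * (c₀ * b₁ + b₀ / (2 * h ^ 2)) +
        K4 * cΘ ^ 2 * (b₁ / (2 * h ^ 2)))) * u ^ 7 := by ring
    _ ≤ _ := mul_le_mul_of_nonneg_left hu78 hK0


/-! ## The transport rate for an admissible kernel family -/

/-- **DIFFERENTIABILITY OF `S_N` ALONG EVERY FREE FLIGHT** for an admissible cell-kernel family, `h > 0`,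
`0 < δ ≤ 1`: for every `N`, start `w` and time `r`. -/
theorem differentiableAt_entS_flight {γ C : ℝ} (hadm : AdmissibleKernel γ C ψ) (hh : 0 < h) (hδ : 0 < δ) (hδ1 : δ ≤ 1)
    (N : ℕ) (w : Cfg N) (r : ℝ) : DifferentiableAt ℝ (fun s => entS N ψ h δ (freeFlight (Torus.geometry (Fin 3)) s w)) r := by
  obtain ⟨hsm, h0, -, -, hC, hgrad⟩ := hadm
  set V : ℝ := ∑ i, ‖(w i).2‖ with hVdef
  have hV : ∀ i, ‖(w i).2‖ ≤ V := fun i =>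
    Finset.single_le_sum (f := fun j => ‖(w j).2‖) (fun j _ => norm_nonneg _) (Finset.mem_univ i)
  have hV0 : 0 ≤ V := (norm_nonneg _).trans (hV 0)
  exact differentiableAt_entS w (hsm N) (h0 N) (hsm N).continuous (hC N) (hgrad N) hV hh hδ hδ1 (Rv_nonneg h δ hV0)
    (fun w' hw' x => abs_Dx_le w' x (h0 N) hh hδ hδ1 (V := V) fun i => by rw [hw' i]; exact hV i) r

/-- **THE TRANSPORT RATE (mechanism (iii) of `stub_entropyBudget`, deterministic part).** For an admissible
cell-kernel family at exponent `γ` with constant `C`, `h > 0`, `0 < δ ≤ 1`, there is `K = K(C, h, δ)` such that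
for every `N` with `(N+1)^{-γ} < 1/2`, every configuration `w` and every velocity bound `V ≥ |v_i|`:
`|d/dr|₀ S_N(freeFlight r w)| ≤ K (N+1)^γ (1 + V)⁸`. -/
theorem transport_rate {γ C : ℝ} (hadm : AdmissibleKernel γ C ψ) (hh : 0 < h) (hδ : 0 < δ) (hδ1 : δ ≤ 1) :
    ∃ K : ℝ, ∀ N : ℕ, ((N : ℝ) + 1) ^ (-γ) < 1 / 2 → ∀ (w : Cfg N) (V : ℝ), (∀ i, ‖(w i).2‖ ≤ V) →
      |deriv (fun s => entS N ψ h δ (freeFlight (Torus.geometry (Fin 3)) s w)) 0| ≤ K * ((N : ℝ) + 1) ^ γ * (1 + V) ^ 8 := by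
  have hC0 := ContactBalance.Pointwise.admissible_C_nonneg hadm
  obtain ⟨hsm, h0, -, hsupp, hC, hgrad⟩ := hadm
  obtain ⟨Kp, hKp⟩ := exists_poly_bound (h := h) hh δ
  refine ⟨C * PastDamping.ballVol * Kp, fun N hRN w V hV => ?_⟩
  have hV0 := V_nonneg w hV
  have hR0 := Rv_nonneg h δ hV0
  have hR : ∀ w' : Cfg N, (∀ i, (w' i).2 = (w i).2) → ∀ x, |((∑ i, Literature.Analysis.FunctionSpaces.Torus.fderiv (ψ N) ((w' i).1 - x) (w' i).2) *
      cellEnt N ψ h δ w' x + ∫ v, (1 + Real.log (cellLaw N ψ h δ w' x v)) * ((1 - δ) *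
      (-(∑ i, Literature.Analysis.FunctionSpaces.Torus.fderiv (ψ N) ((w' i).1 - x) (w' i).2) * kde N ψ h w' x (v) +
      ∑ i, Literature.Analysis.FunctionSpaces.Torus.fderiv (ψ N) ((w' i).1 - x) (w' i).2 * gauss h (w' i).2 (v)) + δ *
      (localMaxwellian 1 (cT N ψ w' x + h ^ 2) (cU N ψ w' x) (v) * ((-(∑ i, Literature.Analysis.FunctionSpaces.Torus.fderiv (ψ N) ((w' i).1 -
      x) (w' i).2) * cT N ψ w' x + ∑ i, Literature.Analysis.FunctionSpaces.Torus.fderiv (ψ N) ((w' i).1 - x) (w' i).2 * (‖(w' i).2 -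
      cU N ψ w' x‖ ^ 2 / 3)) * (‖(v) - cU N ψ w' x‖ ^ 2 / (2 * (cT N ψ w' x + h ^ 2) ^ 2) - 3 / (2 * (cT N ψ w' x + h ^ 2))) + inner ℝ ((v) -
      cU N ψ w' x) (-(∑ i, Literature.Analysis.FunctionSpaces.Torus.fderiv (ψ N) ((w' i).1 - x) (w' i).2) • cU N ψ w' x +
      ∑ i, Literature.Analysis.FunctionSpaces.Torus.fderiv (ψ N) ((w' i).1 - x) (w' i).2 • (w' i).2) / (cT N ψ w' x + h ^ 2)))))| ≤
      (∑ i, |Literature.Analysis.FunctionSpaces.Torus.fderiv (ψ N) ((w' i).1 - x) (w' i).2|) * _ :=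
    fun w' hw' x => abs_Dx_le w' x (h0 N) hh hδ hδ1 (V := V) fun i => by rw [hw' i]; exact hV i
  have hd := hasDerivAt_entS w (hsm N) (h0 N) (hsm N).continuous (hC N) (hgrad N) hV hh hδ hδ1 hR0 hR
  rw [hd.deriv]
  have hb := abs_integral_Dx_le w (h0 N) (hsupp N) (hgrad N) hV hR0 (hR w fun i => rfl) hRN
  have hpow := rpow_support_mul_grad C γ N
  have hNγ : 0 ≤ ((N : ℝ) + 1) ^ γ := Real.rpow_nonneg (by positivity) _
  refine hb.trans ?_
  calc C * ((N : ℝ) + 1) ^ (4 * γ) * V * _ * ((((N : ℝ) + 1) ^ (-γ)) ^ 3 * PastDamping.ballVol)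
      = C * ((N : ℝ) + 1) ^ γ * PastDamping.ballVol * (V * _) := by
        rw [← hpow]; ring
    _ ≤ C * ((N : ℝ) + 1) ^ γ * PastDamping.ballVol * (Kp * (1 + V) ^ 8) :=
        mul_le_mul_of_nonneg_left (hKp V hV0) (mul_nonneg (mul_nonneg hC0 hNγ) PastDamping.ballVol_nonneg)
    _ = C * PastDamping.ballVol * Kp * ((N : ℝ) + 1) ^ γ * (1 + V) ^ 8 := by ring


/-- Hence, for an admissible cell-kernel family: the derivative of `S_N` along a free flight is BOUNDED in time,
for every `N` and start `w`. -/
theorem exists_deriv_entS_bound {γ C : ℝ} (hadm : AdmissibleKernel γ C ψ) (hh : 0 < h) (hδ : 0 < δ) (hδ1 : δ ≤ 1)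
    (N : ℕ) (w : Cfg N) : ∃ B : ℝ, ∀ r : ℝ, |deriv (fun s => entS N ψ h δ (freeFlight (Torus.geometry (Fin 3)) s w)) r| ≤ B := by
  obtain ⟨hsm, h0, -, -, hC, hgrad⟩ := hadm
  set V : ℝ := ∑ i, ‖(w i).2‖ with hVdef
  have hV : ∀ i, ‖(w i).2‖ ≤ V := fun i =>
    Finset.single_le_sum (f := fun j => ‖(w j).2‖) (fun j _ => norm_nonneg _) (Finset.mem_univ i)
  have hV0 : 0 ≤ V := (norm_nonneg _).trans (hV 0)
  exact ⟨_, abs_deriv_entS_le_crude w (hsm N) (h0 N) (hsm N).continuous (hC N) (hgrad N) hV hh hδ hδ1 (Rv_nonneg h δ hV0)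
    (fun w' hw' x => abs_Dx_le w' x (h0 N) hh hδ hδ1 (V := V) fun i => by rw [hw' i]; exact hV i)⟩

end EntropyBudget

/-- Registered anchor of this helper file (`--supports stmt-AtomisticToContinuum-14868`, helper of
`stub_entropyBudget`): the transport rate |d/dr S_N(freeFlight r w)| ≤ K (N+1)^γ (1+V)^8, mechanism (iii). -/
theorem bhEntropyBudget_rate_anchor : ∀ (γ C : ℝ) (ψ : ℕ → T3 → ℝ) (h δ : ℝ), AdmissibleKernel γ C ψ → 0 < h → 0 < δ → δ ≤ 1 →
    ∃ K : ℝ, ∀ N : ℕ, ((N : ℝ) + 1) ^ (-γ) < 1 / 2 → ∀ (w : Cfg N) (V : ℝ), (∀ i, ‖(w i).2‖ ≤ V) →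
    |deriv (fun s => entS N ψ h δ (Literature.Analysis.FluidPDE.freeFlight (Literature.Analysis.FluidPDE.Torus.geometry (Fin 3)) s w)) 0| ≤ K *
    ((N : ℝ) + 1) ^ γ * (1 + V) ^ 8 :=
  fun _ _ _ _ _ hadm hh hδ hδ1 => EntropyBudget.transport_rate hadm hh hδ hδ1

end

end Summit.AtomisticToContinuum.HydrodynamicLimit.Theorems.BlockHDissipation
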